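import Mathlib.RingTheory.Polynomial.Resultant.Basic
import Mathlib.RingTheory.Polynomial.GaussLemma
import Mathlib.RingTheory.Polynomial.UniqueFactorization
import Mathlib.RingTheory.PrincipalIdealDomain
import Mathlib.Algebra.MvPolynomial.Equiv
import Mathlib.Algebra.MvPolynomial.PDeriv
import Mathlib.Algebra.MvPolynomial.NoZeroDivisors
import Mathlib.Logic.Equiv.Option
import Literature.NumberTheory.Transcendental.NesterenkoGenericPoints
import Literature.Algebra.Polynomial.JacobianCriterion
import HarnessLib

/-!
# A polynomial with a root in common with an irreducible polynomial above every point of an open set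
# is divisible by it (Euclidean-open pieces of an irreducible complex hypersurface are Zariski dense)

Family `hodge`, layer `Literature/AlgebraicGeometry/Dimension`; theorems only (no definition, no named fact).

Let `h, p ∈ ℂ[x_σ]` (`σ` finite) with `h` irreducible, and single out one variable `x_k`.  If for every point
`a` of a non-empty (Euclidean) open subset `U ⊆ ℂ^σ` the two univariate polynomials `c ↦ h(a[k ↦ c])`,
`c ↦ p(a[k ↦ c])` have a common root, then `h ∣ p` (`dvd_of_forall_exists_common_root_update`).  This is
the affine-hypersurface case of the density of Euclidean-open subsets of an irreducible complex variety in
the Zariski topology (Shafarevich, *Basic Algebraic Geometry 2*, VII §2.1; Mumford, *Complex projective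
varieties*, §4B): near a smooth point `z₀` of `V(h)` with `∂_k h(z₀) ≠ 0` the zero set is the graph of a
holomorphic function over an open subset of the remaining coordinates, so a polynomial `p` vanishing on a
neighbourhood of `z₀` in `V(h)` satisfies the hypothesis (`dvd_of_vanishes_on_graph`) and hence `h ∣ p`; in
particular no non-zero partial `∂_i h` vanishes there (`pderiv_eq_zero_of_vanishes_on_graph`).

Proof: write `ℂ[x_σ] = R[X]`, `R = ℂ[x_j : j ≠ k]` (`MvPolynomial.optionEquivLeft` after renaming along
`Equiv.optionSubtypeNe k`); if `h` does not involve `X` it vanishes on `U`, impossible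
(`Nesterenko.eq_zero_of_eval_eq_zero_of_isOpen`); otherwise the Sylvester–Bézout identity
`h·A + p·B = Res_X(h, p)` (Mathlib `Polynomial.exists_mul_add_mul_eq_C_resultant`) evaluated at the common
roots shows that `Res_X(h, p) ∈ R` vanishes on the projection of `U`, hence is `0`; over `K = Frac R` a
vanishing resultant means a common factor (`Polynomial.resultant_eq_zero_iff`), `h` stays irreducible in
`K[X]` (Gauss), so `h ∣ p` in `K[X]` and then in `R[X]` (Gauss, `h` primitive):
`Polynomial.dvd_of_resultant_eq_zero_of_irreducible`.

## References

* [Shafarevich1994] I. R. Shafarevich, *Basic Algebraic Geometry*, Springer 1994, Book 1 I §3.1 (resultants);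
  Book 2 VII §2.1 (Euclidean vs. Zariski density on an irreducible variety).
* [GriffithsHarris1978] P. Griffiths, J. Harris, *Principles of Algebraic Geometry*, Wiley 1978, Ch. 0 §2.
-/

noncomputable section

open MvPolynomial
open _root_.Topology

namespace Literature.AlgebraicGeometry.Dimension

variable {σ : Type} [Fintype σ] [DecidableEq σ]

omit [Fintype σ] in
/-- Re-assembling a point from its `k`-th coordinate `c` and the others through
`Equiv.optionSubtypeNe k : Option {j // j ≠ k} ≃ σ` gives `a[k ↦ c]`. [folklore] -/
private theorem optionElim_comp_optionSubtypeNe_symm (k : σ) (a : σ → ℂ) (c : ℂ) :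
    (fun x : Option {j : σ // j ≠ k} => x.elim c (fun t : {j : σ // j ≠ k} => a t.1)) ∘
        (Equiv.optionSubtypeNe k).symm = Function.update a k c := by
  funext j
  by_cases hj : j = k
  · subst hj
    simp
  · simp [Equiv.optionSubtypeNe_symm_of_ne hj, Function.update_of_ne hj]

omit [Fintype σ] in
/-- **Evaluation after singling out `x_k`**: `f(a[k ↦ c])` is the value at `c` of the univariate polynomial
obtained from `optionEquivLeft (rename (optionSubtypeNe k)⁻¹ f) ∈ R[X]` by evaluating its coefficients at
the other coordinates of `a`. [folklore] -/
private theorem eval_update_eq (k : σ) (f : MvPolynomial σ ℂ) (a : σ → ℂ) (c : ℂ) :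
    eval (Function.update a k c) f =
      Polynomial.eval c (Polynomial.map (eval fun t : {j : σ // j ≠ k} => a t.1)
        (optionEquivLeft ℂ {j : σ // j ≠ k} (rename (Equiv.optionSubtypeNe k).symm f))) := by
  have h2 := optionEquivLeft_elim_eval (s := fun t : {j : σ // j ≠ k} => a t.1) (y := c)
    (f := rename (Equiv.optionSubtypeNe k).symm f)
  rw [eval_rename, optionElim_comp_optionSubtypeNe_symm] at h2
  exact h2

omit [Fintype σ] [DecidableEq σ] in
/-- `optionEquivLeft` sends a polynomial in the `some`-variables to the corresponding constant. [folklore] -/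
private theorem optionEquivLeft_rename_some {τ : Type} (g : MvPolynomial τ ℂ) :
    optionEquivLeft ℂ τ (rename some g) = Polynomial.C g := by
  induction g using MvPolynomial.induction_on with
  | C r => rw [rename_C, optionEquivLeft_C]
  | add p q hp hq => rw [map_add, map_add, hp, hq, map_add]
  | mul_X p i hp => rw [map_mul, map_mul, hp, rename_X, optionEquivLeft_X_some, map_mul]

omit [Fintype σ] in
/-- A polynomial not involving `x_k` (degree `0` in `X`) is the `rename` along `Subtype.val` of its constant
coefficient. [folklore] -/
private theorem eq_rename_of_natDegree_eq_zero (k : σ) {f : MvPolynomial σ ℂ}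
    (hf : (optionEquivLeft ℂ {j : σ // j ≠ k} (rename (Equiv.optionSubtypeNe k).symm f)).natDegree = 0) :
    f = rename (Subtype.val : {j : σ // j ≠ k} → σ)
      ((optionEquivLeft ℂ {j : σ // j ≠ k} (rename (Equiv.optionSubtypeNe k).symm f)).coeff 0) := by
  apply rename_injective _ (Equiv.optionSubtypeNe k).symm.injective
  apply (optionEquivLeft ℂ {j : σ // j ≠ k}).injective
  have hcomp : ((Equiv.optionSubtypeNe k).symm ∘ (Subtype.val : {j : σ // j ≠ k} → σ)) = some := by
    funext t
    exact Equiv.optionSubtypeNe_symm_of_ne t.2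
  rw [rename_rename, hcomp, optionEquivLeft_rename_some]
  exact Polynomial.eq_C_of_natDegree_eq_zero hf

omit [Fintype σ] [DecidableEq σ] in
/-- A polynomial `rename Subtype.val g` (`g ∈ ℂ[x_j : j ≠ k]`) evaluates at `a` to `g` at the other
coordinates of `a`. [folklore] -/
private theorem eval_rename_subtypeVal (k : σ) (g : MvPolynomial {j : σ // j ≠ k} ℂ) (a : σ → ℂ) :
    eval a (rename (Subtype.val : {j : σ // j ≠ k} → σ) g) = eval (fun t : {j : σ // j ≠ k} => a t.1) g := by
  rw [eval_rename]
  rfl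

omit [DecidableEq σ] in
/-- If `g ∈ ℂ[x_j : j ≠ k]` vanishes at the other coordinates of every point of a non-empty open `U ⊆ ℂ^σ`,
then `g = 0` (identity theorem, through `rename Subtype.val`). [folklore] -/
private theorem eq_zero_of_forall_eval_drop_eq_zero (k : σ) {g : MvPolynomial {j : σ // j ≠ k} ℂ}
    {U : Set (σ → ℂ)} (hU : IsOpen U) (hne : U.Nonempty)
    (h : ∀ a ∈ U, eval (fun t : {j : σ // j ≠ k} => a t.1) g = 0) : g = 0 := by
  have h' : rename (Subtype.val : {j : σ // j ≠ k} → σ) g = 0 :=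
    Literature.NumberTheory.Transcendental.Nesterenko.eq_zero_of_eval_eq_zero_of_isOpen _ hU hne
      fun a ha => by rw [eval_rename_subtypeVal]; exact h a ha
  exact rename_injective _ Subtype.val_injective (by rw [h', map_zero])

/-- **Vanishing resultant against an irreducible polynomial means divisibility** (over a UFD `R` with
fraction field `K`): if `f ∈ R[X]` is irreducible of positive degree and `Res(f, g) = 0`, then `f ∣ g`
(`Res = 0` over `K` means a common factor, `f` stays irreducible in `K[X]` and is primitive — Gauss's lemma).
Declared in the `Polynomial` namespace as a dot-notation-free extension next to `Polynomial.resultant_eq_zero_iff`.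
[cite: Shafarevich1994, Book 1 I §3.1 (characteristic property of the resultant)] -/
theorem _root_.Polynomial.dvd_of_resultant_eq_zero_of_irreducible {R : Type*} [CommRing R] [IsDomain R]
    [UniqueFactorizationMonoid R] (K : Type*) [Field K] [Algebra R K] [IsFractionRing R K]
    {f g : Polynomial R} (hf : Irreducible f) (hdeg : f.natDegree ≠ 0)
    (hres : Polynomial.resultant f g = 0) : f ∣ g := by
  have hι : Function.Injective (algebraMap R K) := IsFractionRing.injective R K
  have hresK : Polynomial.resultant (f.map (algebraMap R K)) (g.map (algebraMap R K)) = 0 := by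
    have h1 : (f.map (algebraMap R K)).natDegree = f.natDegree :=
      Polynomial.natDegree_map_eq_of_injective hι _
    have h2 : (g.map (algebraMap R K)).natDegree = g.natDegree :=
      Polynomial.natDegree_map_eq_of_injective hι _
    rw [h1, h2, Polynomial.resultant_map_map, hres, map_zero]
  have hnc : ¬ IsCoprime (f.map (algebraMap R K)) (g.map (algebraMap R K)) :=
    (Polynomial.resultant_eq_zero_iff.mp hresK).2
  have hprim : f.IsPrimitive := hf.isPrimitive hdeg
  have hirrK : Irreducible (f.map (algebraMap R K)) :=
    (hprim.irreducible_iff_irreducible_map_fraction_map (K := K)).mp hf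
  have hdvdK : f.map (algebraMap R K) ∣ g.map (algebraMap R K) :=
    (EuclideanDomain.dvd_or_coprime _ _ hirrK).resolve_right hnc
  exact hprim.dvd_of_fraction_map_dvd_fraction_map (K := K) hdvdK

/-- **Identity principle on an irreducible hypersurface (resultant form).**  Let `h ∈ ℂ[x_σ]` be
irreducible and `p ∈ ℂ[x_σ]`.  If above every point of a non-empty open set `U ⊆ ℂ^σ` the univariate
polynomials `c ↦ h(a[k ↦ c])` and `c ↦ p(a[k ↦ c])` have a common root, then `h ∣ p`.
[cite: Shafarevich1994, Book 2 VII §2.1 (with Book 1 I §3.1)] -/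
theorem dvd_of_forall_exists_common_root_update (k : σ) {h p : MvPolynomial σ ℂ} (hh : Irreducible h)
    {U : Set (σ → ℂ)} (hU : IsOpen U) (hne : U.Nonempty)
    (H : ∀ a ∈ U, ∃ c : ℂ, eval (Function.update a k c) h = 0 ∧ eval (Function.update a k c) p = 0) :
    h ∣ p := by
  classical
  set e := (Equiv.optionSubtypeNe k).symm with he
  set Hk := optionEquivLeft ℂ {j : σ // j ≠ k} (rename e h) with hHk
  set Pk := optionEquivLeft ℂ {j : σ // j ≠ k} (rename e p) with hPk
  have hHirr : Irreducible Hk := by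
    have h1 : Irreducible (rename e h) :=
      (MulEquiv.irreducible_iff (renameEquiv ℂ e).toMulEquiv).mpr hh
    exact (MulEquiv.irreducible_iff (optionEquivLeft ℂ {j : σ // j ≠ k}).toMulEquiv).mpr h1
  by_cases hdeg : Hk.natDegree = 0
  · -- `h` does not involve `x_k`: it vanishes on `U`, contradiction
    exfalso
    have hC := eq_rename_of_natDegree_eq_zero k (f := h) hdeg
    have hzero : Hk.coeff 0 = 0 := by
      refine eq_zero_of_forall_eval_drop_eq_zero k hU hne fun a ha => ?_
      obtain ⟨c, hc, -⟩ := H a ha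
      rw [hC, eval_rename_subtypeVal] at hc
      have hupd : (fun t : {j : σ // j ≠ k} => Function.update a k c t.1) =
          fun t : {j : σ // j ≠ k} => a t.1 := funext fun t => Function.update_of_ne t.2 _ _
      rw [hupd] at hc
      exact hc
    apply hh.ne_zero
    rw [hC, ← hHk, hzero, map_zero]
  · -- the resultant with respect to `x_k` vanishes on the projection of `U`, hence is zero
    obtain ⟨A, B, -, -, hAB⟩ :=
      Polynomial.exists_mul_add_mul_eq_C_resultant Hk Pk le_rfl le_rfl (Or.inl hdeg)
    have hres : Polynomial.resultant Hk Pk = 0 := by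
      refine eq_zero_of_forall_eval_drop_eq_zero k hU hne fun a ha => ?_
      obtain ⟨c, hc1, hc2⟩ := H a ha
      rw [eval_update_eq, ← he, ← hHk] at hc1
      rw [eval_update_eq, ← he, ← hPk] at hc2
      have := congr_arg
        (fun q => Polynomial.eval c (Polynomial.map (eval fun t : {j : σ // j ≠ k} => a t.1) q)) hAB
      simp only [Polynomial.map_add, Polynomial.map_mul, Polynomial.eval_add, Polynomial.eval_mul, hc1, hc2,
        zero_mul, zero_add, Polynomial.map_C, Polynomial.eval_C] at this
      exact this.symm
    -- Gauss + `Res = 0 ⇒ common factor` over the fraction field of `R = ℂ[x_j : j ≠ k]`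
    have hdvd : Hk ∣ Pk := Polynomial.dvd_of_resultant_eq_zero_of_irreducible
      (FractionRing (MvPolynomial {j : σ // j ≠ k} ℂ)) hHirr hdeg hres
    -- back to `ℂ[x_σ]`
    have h1 : rename e h ∣ rename e p := by
      have := map_dvd (optionEquivLeft ℂ {j : σ // j ≠ k}).symm hdvd
      rwa [hHk, hPk, AlgEquiv.symm_apply_apply, AlgEquiv.symm_apply_apply] at this
    have h2 := map_dvd (rename (R := ℂ) e.symm) h1
    rw [rename_rename, rename_rename, e.symm_comp_self] at h2
    simpa only [rename_id, AlgHom.id_apply] using h2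

/-- **Identity principle on an irreducible hypersurface (graph form).**  Let `h ∈ ℂ[x_σ]` be irreducible
and suppose that over a non-empty open set `U ⊆ ℂ^σ` the hypersurface `V(h)` contains the graph of a function
`c : ℂ^σ → ℂ` in the `x_k`-direction (`h(a[k ↦ c a]) = 0` for `a ∈ U`) on which `p` vanishes too.  Then
`h ∣ p`. [cite: Shafarevich1994, Book 2 VII §2.1] -/
theorem dvd_of_vanishes_on_graph (k : σ) {h p : MvPolynomial σ ℂ} (hh : Irreducible h)
    {U : Set (σ → ℂ)} (hU : IsOpen U) (hne : U.Nonempty) (c : (σ → ℂ) → ℂ)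
    (hhc : ∀ a ∈ U, eval (Function.update a k (c a)) h = 0)
    (hpc : ∀ a ∈ U, eval (Function.update a k (c a)) p = 0) : h ∣ p :=
  dvd_of_forall_exists_common_root_update k hh hU hne fun a ha => ⟨c a, hhc a ha, hpc a ha⟩

/-- **Corollary (no non-zero partial vanishes along the hypersurface).**  If `h` is irreducible and all the
points `a[k ↦ c a]`, `a ∈ U` (`U` open, non-empty), are common zeros of `h` and of its partial derivative
`∂_i h`, then `∂_i h = 0`: an irreducible polynomial does not divide a non-zero polynomial of smaller total
degree. [cite: Shafarevich1994, Book 2 VII §2.1] -/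
theorem pderiv_eq_zero_of_vanishes_on_graph (k i : σ) {h : MvPolynomial σ ℂ} (hh : Irreducible h)
    {U : Set (σ → ℂ)} (hU : IsOpen U) (hne : U.Nonempty) (c : (σ → ℂ) → ℂ)
    (hhc : ∀ a ∈ U, eval (Function.update a k (c a)) h = 0)
    (hpc : ∀ a ∈ U, eval (Function.update a k (c a)) (pderiv i h) = 0) : pderiv i h = 0 := by
  have hdvd := dvd_of_vanishes_on_graph k hh hU hne c hhc hpc
  by_contra hne0
  have hle : h.totalDegree ≤ (pderiv i h).totalDegree := totalDegree_le_of_dvd_of_isDomain hdvd hne0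
  have hlt : (pderiv i h).totalDegree < h.totalDegree :=
    Literature.Algebra.Polynomial.JacobianCriterion.totalDegree_pderiv_lt hne0
  exact absurd hle (not_le.mpr hlt)

/-- **All partials at once**: under the same hypothesis for every `i`, the irreducible `h` would be a
constant — so an irreducible polynomial is never singular along a Euclidean-open piece of its zero set
presented as such a graph. [cite: Shafarevich1994, Book 2 VII §2.1] -/
theorem false_of_forall_pderiv_vanishes_on_graph (k : σ) {h : MvPolynomial σ ℂ} (hh : Irreducible h)
    {U : Set (σ → ℂ)} (hU : IsOpen U) (hne : U.Nonempty) (c : (σ → ℂ) → ℂ)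
    (hhc : ∀ a ∈ U, eval (Function.update a k (c a)) h = 0)
    (hpc : ∀ i, ∀ a ∈ U, eval (Function.update a k (c a)) (pderiv i h) = 0) : False := by
  -- all partials vanish, so `h` is a constant (characteristic `0`), contradicting irreducibility + a zero
  have hall : ∀ i, pderiv i h = 0 := fun i => pderiv_eq_zero_of_vanishes_on_graph k i hh hU hne c hhc (hpc i)
  obtain ⟨a, ha⟩ := hne
  have hC : h = C (coeff 0 h) := Literature.Algebra.Polynomial.JacobianCriterion.eq_C_of_forall_pderiv_eq_zero hall
  have hval : eval (Function.update a k (c a)) h = coeff 0 h := by rw [hC, eval_C, coeff_C, if_pos rfl]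
  have h0 : coeff 0 h = 0 := by rw [← hval]; exact hhc a ha
  exact hh.ne_zero (by rw [hC, h0, map_zero])

end Literature.AlgebraicGeometry.Dimension

end
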